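import Summits.ValiantsHypothesis.ValiantsHypothesis.Theorems.LacunarySymmetroidMatrixDescartesCensusDoorA34NullTopBlocks
import Summits.ValiantsHypothesis.ValiantsHypothesis.Theorems.LacunarySymmetroidMatrixDescartesCensusDoorA34FlagLaw
import Summits.ValiantsHypothesis.ValiantsHypothesis.Theorems.LacunarySymmetroidMatrixDescartesCensusDoorA34TwoSingularLetters

/-!
# `MatrixDescartes` census — DOOR A at `(3,4)`: the codimension-one SUB-STRATA `tr(adj S₃ · S₂) = 0` of the strata line close by monomial count

HONEST FRAMING.  Object-search cell `pub-symmetroid`, door-A seat `val-sym-door-p3` (g11); helper rows for the registered strata line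
`Cruxes/DoorA34/Lines/strata.lean` on stmt-ValiantsHypothesis-19980 (`DoorA34 = PosRootLawAt 3 4 18`: OPEN, typed, never asserted here).
The line's stubs `stub_nullTopCeiling` (top letter singular ⇒ `≤ 17`) and `stub_nullNullCeiling` (both end letters singular ⇒ `≤ 16`)
are deficiency-ONE statements on their strata (Descartes allows `18` resp. `17`, kernel `posRoots_le_18_of_det_letter_eq_zero` /
`posRoots_le_17_of_singular_ends`).  This file proves them OUTRIGHT on the codimension-one sub-strata where, in addition, the TOP
SURVIVING COEFFICIENT vanishes: by the block identity `det F = det G + X^{d₃}·tr(adj G · S₃) + X^{2d₃}·tr(adj S₃ · G)` on `{det S₃ = 0}`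
(`Census.det_pencil_nullTop_eq_blocks`, `G` = the three lower letters), the `X^{2d₃}`-block is `Σ_{l<3} X^{d_l}·tr(adj S₃ · S_l)`, so
`tr(adj S₃ · S₂) = 0` deletes one more monomial:

* `support_det_pencil_nullTop_subset` — on `{det S₃ = 0, tr(adj S₃·S₂) = 0}` the support of `det F` lies in
  `(triple sums of d₀,d₁,d₂) ∪ (d₃ + pair sums of d₀,d₁,d₂) ∪ {2d₃ + d₀, 2d₃ + d₁}` (any `d`, any real letters);
* `posRoots_le_17_of_nullTop_of_trace_adjugate_eq_zero` — `det S₃ = 0 ∧ tr(adj S₃ · S₂) = 0 ⇒ ≤ 18` monomials `⇒ ≤ 17` distinct positive roots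
  (ANY `d : Fin 4 → ℕ`, any real `3 × 3` letters — no symmetry, no monotonicity needed);
* `posRoots_le_16_of_nullNull_of_trace_adjugate_eq_zero` — if moreover `det S₀ = 0` and the bottom cube `3·d₀` is uniquely represented
  among the triple sums of the three lower exponents (automatic for strictly increasing `d`), then `≤ 17` monomials `⇒ ≤ 16` roots;
  `posRoots_le_16_of_nullNull_of_trace_adjugate_eq_zero'` is the `StrictMono d` form matching the stub's hypotheses plus the extra one.

So the OPEN part of both stubs is the generic sheet `tr(adj S₃ · S₂) ≠ 0` of each stratum (for a rank-`2` top letter with kernel `k`: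
`kᵀ S₂ k ≠ 0`).  Nothing here bounds `ζ_sym(3,4)`; nothing on `MatrixDescartes` (stmt-ValiantsHypothesis-18050) or `VP ≠ VNP`.
[folklore] Sparse Descartes bound (`#roots < #monomials`, `Literature…card_roots_toFinset_filter_pos_lt_card_support`); elementary.
-/

-- `Summit.ValiantsHypothesis.ValiantsHypothesis.…` repeats a component by the D-0017 layout
-- (single-conjunct summit), which the `dupNamespace` linter flags; the name is mandated.
set_option linter.dupNamespace false

namespace Summit.ValiantsHypothesis.ValiantsHypothesis.Theorems.LacunarySymmetroidMatrixDescartes.Census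

open Polynomial Finset
open scoped BigOperators Polynomial Matrix

/-- The `X^{2d₃}`-block on the null-top stratum, written out letter by letter:
`tr(adj(S₃) · G(X)) = Σ_{l<3} X^{d_l} · C(tr(adj S₃ · S_l))` for `G = Σ_{l<3} X^{d_l} S_l`. [folklore] -/
theorem trace_adjugate_map_mul_corePencil (d : Fin 4 → ℕ) (S : Fin 4 → Matrix (Fin 3) (Fin 3) ℝ) :
    (((S 3).map C).adjugate * (∑ l : Fin 3, (X : ℝ[X]) ^ d (Fin.castSucc l) • (S (Fin.castSucc l)).map C)).trace
      = ∑ l : Fin 3, (X : ℝ[X]) ^ d (Fin.castSucc l) * C (((S 3).adjugate * S (Fin.castSucc l)).trace) := by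
  have hmap : ((S 3).map C).adjugate = ((S 3).adjugate).map C := by
    rw [← RingHom.mapMatrix_apply, ← RingHom.map_adjugate, RingHom.mapMatrix_apply]
  rw [hmap, Matrix.mul_sum, Matrix.trace_sum]
  refine Finset.sum_congr rfl fun l _ => ?_
  rw [Matrix.mul_smul, Matrix.trace_smul, ← Matrix.map_mul, smul_eq_mul]
  congr 1
  simp only [Matrix.trace, Matrix.diag, Matrix.map_apply, map_sum]

/-- The cube `3·d l` is among the triple sums of three exponents. [folklore] -/
theorem three_mul_mem_sumset_three (d : Fin 3 → ℕ) (l : Fin 3) :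
    3 * d l ∈ (Finset.univ : Finset (Sym (Fin 3) 3)).image (fun s : Sym (Fin 3) 3 => ((s : Multiset (Fin 3)).map d).sum) := by
  refine Finset.mem_image.mpr ⟨Sym.replicate 3 l, Finset.mem_univ _, ?_⟩
  simp only [Sym.coe_replicate, Multiset.map_replicate, Multiset.sum_replicate, smul_eq_mul]

/-- **Support of the determinant on the null-top sub-stratum** (any `d`, any real letters): with `det S₃ = 0` and
`tr(adj S₃·S₂) = 0`, `supp(det F) ⊆ (T₃ ∪ (d₃ + P₃)) ∪ {2d₃ + d₀, 2d₃ + d₁}`, where `T₃` are the triple sums and `P₃` the pair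
sums of the three lower exponents. [folklore] -/
theorem support_det_pencil_nullTop_subset (d : Fin 4 → ℕ) (S : Fin 4 → Matrix (Fin 3) (Fin 3) ℝ) (h3 : (S 3).det = 0)
    (htr : ((S 3).adjugate * S 2).trace = 0) :
    (Matrix.det (∑ l, ((X : ℝ[X]) ^ d l) • (S l).map C)).support ⊆
      ((Finset.univ : Finset (Sym (Fin 3) 3)).image
          (fun s : Sym (Fin 3) 3 => ((s : Multiset (Fin 3)).map (fun l => d (Fin.castSucc l))).sum)
        ∪ (Finset.univ : Finset (Fin 2 → Fin 3)).image (fun f => d 3 + ∑ i, d (Fin.castSucc (f i))))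
      ∪ ({2 * d 3 + d 0, 2 * d 3 + d 1} : Finset ℕ) := by
  intro n hn
  have hP := det_pencil_nullTop_eq_blocks d S h3
  rw [hP] at hn
  rcases Finset.mem_union.mp (Polynomial.support_add hn) with h12 | hC
  · rcases Finset.mem_union.mp (Polynomial.support_add h12) with hA | hB
    · -- block `det G`
      exact Finset.mem_union_left _ (Finset.mem_union_left _
        (StubDescartesCeiling.support_det_pencil_subset (fun l : Fin 3 => d (Fin.castSucc l))
          (fun l => S (Fin.castSucc l)) hA))
    · -- block `X^{d₃} · tr(adj G · S₃)`
      refine Finset.mem_union_left _ (Finset.mem_union_right _ ?_)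
      rw [Polynomial.mem_support_iff, Polynomial.coeff_X_pow_mul'] at hB
      split_ifs at hB with hle
      · have hmem : n - d 3 ∈ (Finset.univ : Finset (Fin 2 → Fin 3)).image (fun f => ∑ i, d (Fin.castSucc (f i))) := by
          by_contra hni
          apply hB
          simp only [Matrix.trace, Matrix.diag, Matrix.mul_apply, Matrix.map_apply, Polynomial.finsetSum_coeff,
            Polynomial.coeff_mul_C]
          refine Finset.sum_eq_zero fun i _ => Finset.sum_eq_zero fun j _ => ?_
          have h0 : ((∑ l : Fin 3, ((X : ℝ[X]) ^ d (Fin.castSucc l)) • (S (Fin.castSucc l)).map C).adjugate i j).coeff (n - d 3) = 0 :=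
            Polynomial.notMem_support_iff.mp fun h =>
              hni (support_adjugate_pencil_apply_subset' (fun l : Fin 3 => d (Fin.castSucc l)) (fun l => S (Fin.castSucc l)) i j h)
          rw [h0, zero_mul]
        obtain ⟨f, hf, hfs⟩ := Finset.mem_image.mp hmem
        exact Finset.mem_image.mpr ⟨f, hf, by omega⟩
      · exact absurd rfl hB
  · -- block `X^{2d₃} · tr(adj S₃ · G)`
    refine Finset.mem_union_right _ ?_
    rw [trace_adjugate_map_mul_corePencil, ← pow_mul, Polynomial.mem_support_iff, Polynomial.coeff_X_pow_mul'] at hC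
    split_ifs at hC with hle
    · rw [Polynomial.finsetSum_coeff] at hC
      obtain ⟨l, -, hl⟩ := Finset.exists_ne_zero_of_sum_ne_zero hC
      rw [Polynomial.coeff_X_pow_mul'] at hl
      split_ifs at hl with hle'
      · rw [Polynomial.coeff_C] at hl
        split_ifs at hl with heq
        · have hn2 : n = 2 * d 3 + d (Fin.castSucc l) := by omega
          fin_cases l
          · exact Finset.mem_insert.mpr (Or.inl (by simpa using hn2))
          · exact Finset.mem_insert.mpr (Or.inr (Finset.mem_singleton.mpr (by simpa using hn2)))
          · exact absurd (by simpa using htr) hl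
        · exact absurd rfl hl
      · exact absurd rfl hl
    · exact absurd rfl hC

/-- **Null-top sub-stratum `tr(adj S₃ · S₂) = 0` ⇒ at most `18` monomials** (any `d`, any real letters). [folklore] -/
theorem card_support_le_18_of_nullTop_of_trace_adjugate_eq_zero (d : Fin 4 → ℕ) (S : Fin 4 → Matrix (Fin 3) (Fin 3) ℝ)
    (h3 : (S 3).det = 0) (htr : ((S 3).adjugate * S 2).trace = 0) :
    (Matrix.det (∑ l, ((X : ℝ[X]) ^ d l) • (S l).map C)).support.card ≤ 18 := by
  classical
  refine (Finset.card_le_card (support_det_pencil_nullTop_subset d S h3 htr)).trans ?_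
  have hA : ((Finset.univ : Finset (Sym (Fin 3) 3)).image
      (fun s : Sym (Fin 3) 3 => ((s : Multiset (Fin 3)).map (fun l => d (Fin.castSucc l))).sum)).card ≤ 10 :=
    Finset.card_image_le.trans (by rw [Finset.card_univ, Sym.card_sym_eq_choose]; decide)
  have hB : ((Finset.univ : Finset (Fin 2 → Fin 3)).image (fun f => d 3 + ∑ i, d (Fin.castSucc (f i)))).card ≤ 6 := by
    have h6 := card_pairSums_three_le (fun l : Fin 3 => d (Fin.castSucc l))
    have : (Finset.univ : Finset (Fin 2 → Fin 3)).image (fun f => d 3 + ∑ i, d (Fin.castSucc (f i)))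
        = ((Finset.univ : Finset (Fin 2 → Fin 3)).image (fun f => ∑ i, d (Fin.castSucc (f i)))).image (fun n => d 3 + n) := by
      rw [Finset.image_image]; rfl
    rw [this]
    exact Finset.card_image_le.trans h6
  have hC : (({2 * d 3 + d 0, 2 * d 3 + d 1} : Finset ℕ)).card ≤ 2 :=
    (Finset.card_insert_le _ _).trans (by rw [Finset.card_singleton])
  have h1 := Finset.card_union_le
    ((Finset.univ : Finset (Sym (Fin 3) 3)).image
      (fun s : Sym (Fin 3) 3 => ((s : Multiset (Fin 3)).map (fun l => d (Fin.castSucc l))).sum))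
    ((Finset.univ : Finset (Fin 2 → Fin 3)).image (fun f => d 3 + ∑ i, d (Fin.castSucc (f i))))
  have h2 := Finset.card_union_le
    (((Finset.univ : Finset (Sym (Fin 3) 3)).image
        (fun s : Sym (Fin 3) 3 => ((s : Multiset (Fin 3)).map (fun l => d (Fin.castSucc l))).sum)
      ∪ (Finset.univ : Finset (Fin 2 → Fin 3)).image (fun f => d 3 + ∑ i, d (Fin.castSucc (f i)))))
    ({2 * d 3 + d 0, 2 * d 3 + d 1} : Finset ℕ)
  omega

/-- **`stub_nullTopCeiling` on the sub-stratum `tr(adj S₃ · S₂) = 0`**: a real `(3,4)` pencil (any support, any real letters) with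
`det S₃ = 0` and `tr(adj S₃ · S₂) = 0` has at most `17` distinct positive determinant roots. [folklore] -/
theorem posRoots_le_17_of_nullTop_of_trace_adjugate_eq_zero (d : Fin 4 → ℕ) (S : Fin 4 → Matrix (Fin 3) (Fin 3) ℝ)
    (h3 : (S 3).det = 0) (htr : ((S 3).adjugate * S 2).trace = 0) :
    ((Matrix.det (∑ l, ((X : ℝ[X]) ^ d l) • (S l).map C)).roots.toFinset.filter (fun t => 0 < t)).card ≤ 17 := by
  by_cases hP : Matrix.det (∑ l, ((X : ℝ[X]) ^ d l) • (S l).map C) = 0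
  · rw [hP, Polynomial.roots_zero, Multiset.toFinset_zero, Finset.filter_empty, Finset.card_empty]; omega
  have hlt := Literature.Computability.AlgebraicComplexity.card_roots_toFinset_filter_pos_lt_card_support hP
  have h18 := card_support_le_18_of_nullTop_of_trace_adjugate_eq_zero d S h3 htr
  omega

/-- **Null-null sub-stratum `tr(adj S₃ · S₂) = 0` ⇒ at most `17` monomials**, when the bottom cube `3·d₀` is uniquely represented
among the triple sums of the three lower exponents. [folklore] -/
theorem card_support_le_17_of_nullNull_of_trace_adjugate_eq_zero (d : Fin 4 → ℕ) (S : Fin 4 → Matrix (Fin 3) (Fin 3) ℝ)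
    (h30 : ∀ f : Fin 3 → Fin 3, (∑ k, d (Fin.castSucc (f k))) = 3 * d 0 → ∀ k, f k = 0)
    (hlow : ∀ f : Fin 2 → Fin 3, d 3 + ∑ i, d (Fin.castSucc (f i)) ≠ 3 * d 0)
    (htop : ∀ l : Fin 3, 2 * d 3 + d (Fin.castSucc l) ≠ 3 * d 0)
    (h0 : (S 0).det = 0) (h3 : (S 3).det = 0) (htr : ((S 3).adjugate * S 2).trace = 0) :
    (Matrix.det (∑ l, ((X : ℝ[X]) ^ d l) • (S l).map C)).support.card ≤ 17 := by
  classical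
  set P := Matrix.det (∑ l, ((X : ℝ[X]) ^ d l) • (S l).map C) with hP
  -- the bottom cube is not in the support: its coefficient is `det S₀ = 0`
  have hcube : P.coeff (3 * d 0) = 0 := by
    rw [hP, det_pencil_nullTop_eq_blocks d S h3, Polynomial.coeff_add, Polynomial.coeff_add]
    have hG : (Matrix.det (∑ l : Fin 3, ((X : ℝ[X]) ^ d (Fin.castSucc l)) • (S (Fin.castSucc l)).map C)).coeff (3 * d 0)
        = (S 0).det := by
      rw [coeff_det_pencil (fun l : Fin 3 => d (Fin.castSucc l)) (fun l => S (Fin.castSucc l)) (3 * d 0), Matrix.det_apply']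
      refine Finset.sum_congr rfl fun σ _ => ?_
      rw [Finset.sum_eq_single (fun _ => (0 : Fin 3))]
      · have hs : (∑ _i : Fin 3, d (Fin.castSucc (0 : Fin 3))) = 3 * d 0 := by simp [Finset.sum_const]
        simp only [hs, if_true]
        rfl
      · intro f _ hf
        rw [if_neg]
        intro h
        exact hf (funext fun i => h30 f h.symm i)
      · intro h; exact absurd (Finset.mem_univ _) h
    have hB : ((X : ℝ[X]) ^ d 3 * ((∑ l : Fin 3, (X : ℝ[X]) ^ d (Fin.castSucc l) • (S (Fin.castSucc l)).map C).adjugate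
        * (S 3).map C).trace).coeff (3 * d 0) = 0 := by
      rw [Polynomial.coeff_X_pow_mul']
      split_ifs with hle
      · simp only [Matrix.trace, Matrix.diag, Matrix.mul_apply, Matrix.map_apply, Polynomial.finsetSum_coeff,
          Polynomial.coeff_mul_C]
        refine Finset.sum_eq_zero fun i _ => Finset.sum_eq_zero fun j _ => ?_
        have h0' : ((∑ l : Fin 3, ((X : ℝ[X]) ^ d (Fin.castSucc l)) • (S (Fin.castSucc l)).map C).adjugate i j).coeff
            (3 * d 0 - d 3) = 0 := by
          refine Polynomial.notMem_support_iff.mp fun h => ?_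
          have hm := support_adjugate_pencil_apply_subset' (fun l : Fin 3 => d (Fin.castSucc l))
            (fun l => S (Fin.castSucc l)) i j h
          obtain ⟨f, -, hf⟩ := Finset.mem_image.mp hm
          exact hlow f (by omega)
        rw [h0', zero_mul]
      · rfl
    have hCc : ((((X : ℝ[X]) ^ d 3) ^ 2) * (((S 3).map C).adjugate
        * (∑ l : Fin 3, (X : ℝ[X]) ^ d (Fin.castSucc l) • (S (Fin.castSucc l)).map C)).trace).coeff (3 * d 0) = 0 := by
      rw [trace_adjugate_map_mul_corePencil, ← pow_mul, Polynomial.coeff_X_pow_mul']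
      split_ifs with hle
      · rw [Polynomial.finsetSum_coeff]
        refine Finset.sum_eq_zero fun l _ => ?_
        rw [Polynomial.coeff_X_pow_mul']
        split_ifs with hle'
        · rw [Polynomial.coeff_C, if_neg]
          intro heq; exact htop l (by omega)
        · rfl
      · rfl
    rw [hG, h0, hB, hCc]; ring
  have hmem : 3 * d 0 ∈ (Finset.univ : Finset (Sym (Fin 3) 3)).image
      (fun s : Sym (Fin 3) 3 => ((s : Multiset (Fin 3)).map (fun l => d (Fin.castSucc l))).sum) :=
    three_mul_mem_sumset_three (fun l : Fin 3 => d (Fin.castSucc l)) 0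
  have hsub := support_det_pencil_nullTop_subset d S h3 htr
  have hnot : 3 * d 0 ∉ P.support := by rw [Polynomial.mem_support_iff, hcube]; exact fun h => h rfl
  -- the 18-set
  have hA : ((Finset.univ : Finset (Sym (Fin 3) 3)).image
      (fun s : Sym (Fin 3) 3 => ((s : Multiset (Fin 3)).map (fun l => d (Fin.castSucc l))).sum)).card ≤ 10 :=
    Finset.card_image_le.trans (by rw [Finset.card_univ, Sym.card_sym_eq_choose]; decide)
  have hBc : ((Finset.univ : Finset (Fin 2 → Fin 3)).image (fun f => d 3 + ∑ i, d (Fin.castSucc (f i)))).card ≤ 6 := by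
    have h6 := card_pairSums_three_le (fun l : Fin 3 => d (Fin.castSucc l))
    have : (Finset.univ : Finset (Fin 2 → Fin 3)).image (fun f => d 3 + ∑ i, d (Fin.castSucc (f i)))
        = ((Finset.univ : Finset (Fin 2 → Fin 3)).image (fun f => ∑ i, d (Fin.castSucc (f i)))).image (fun n => d 3 + n) := by
      rw [Finset.image_image]; rfl
    rw [this]; exact Finset.card_image_le.trans h6
  have hC2 : (({2 * d 3 + d 0, 2 * d 3 + d 1} : Finset ℕ)).card ≤ 2 :=
    (Finset.card_insert_le _ _).trans (by rw [Finset.card_singleton])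
  have h1 := Finset.card_union_le
    ((Finset.univ : Finset (Sym (Fin 3) 3)).image
      (fun s : Sym (Fin 3) 3 => ((s : Multiset (Fin 3)).map (fun l => d (Fin.castSucc l))).sum))
    ((Finset.univ : Finset (Fin 2 → Fin 3)).image (fun f => d 3 + ∑ i, d (Fin.castSucc (f i))))
  have h2 := Finset.card_union_le
    (((Finset.univ : Finset (Sym (Fin 3) 3)).image
        (fun s : Sym (Fin 3) 3 => ((s : Multiset (Fin 3)).map (fun l => d (Fin.castSucc l))).sum)
      ∪ (Finset.univ : Finset (Fin 2 → Fin 3)).image (fun f => d 3 + ∑ i, d (Fin.castSucc (f i)))))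
    ({2 * d 3 + d 0, 2 * d 3 + d 1} : Finset ℕ)
  have hmemU : 3 * d 0 ∈ ((Finset.univ : Finset (Sym (Fin 3) 3)).image
          (fun s : Sym (Fin 3) 3 => ((s : Multiset (Fin 3)).map (fun l => d (Fin.castSucc l))).sum)
        ∪ (Finset.univ : Finset (Fin 2 → Fin 3)).image (fun f => d 3 + ∑ i, d (Fin.castSucc (f i))))
      ∪ ({2 * d 3 + d 0, 2 * d 3 + d 1} : Finset ℕ) :=
    Finset.mem_union_left _ (Finset.mem_union_left _ hmem)
  have hsub' : P.support ⊆ (((Finset.univ : Finset (Sym (Fin 3) 3)).image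
          (fun s : Sym (Fin 3) 3 => ((s : Multiset (Fin 3)).map (fun l => d (Fin.castSucc l))).sum)
        ∪ (Finset.univ : Finset (Fin 2 → Fin 3)).image (fun f => d 3 + ∑ i, d (Fin.castSucc (f i))))
      ∪ ({2 * d 3 + d 0, 2 * d 3 + d 1} : Finset ℕ)).erase (3 * d 0) := fun n hn =>
    Finset.mem_erase.mpr ⟨fun h => hnot (h ▸ hn), hsub hn⟩
  have hle := Finset.card_le_card hsub'
  rw [Finset.card_erase_of_mem hmemU] at hle
  omega

/-- **`stub_nullNullCeiling` on the sub-stratum `tr(adj S₃ · S₂) = 0`** (exponent form): both end letters singular, the extra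
vanishing, and the three exponent-uniqueness conditions (all automatic for strictly increasing `d`) give at most `16` distinct positive
determinant roots. [folklore] -/
theorem posRoots_le_16_of_nullNull_of_trace_adjugate_eq_zero (d : Fin 4 → ℕ) (S : Fin 4 → Matrix (Fin 3) (Fin 3) ℝ)
    (h30 : ∀ f : Fin 3 → Fin 3, (∑ k, d (Fin.castSucc (f k))) = 3 * d 0 → ∀ k, f k = 0)
    (hlow : ∀ f : Fin 2 → Fin 3, d 3 + ∑ i, d (Fin.castSucc (f i)) ≠ 3 * d 0)
    (htop : ∀ l : Fin 3, 2 * d 3 + d (Fin.castSucc l) ≠ 3 * d 0)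
    (h0 : (S 0).det = 0) (h3 : (S 3).det = 0) (htr : ((S 3).adjugate * S 2).trace = 0) :
    ((Matrix.det (∑ l, ((X : ℝ[X]) ^ d l) • (S l).map C)).roots.toFinset.filter (fun t => 0 < t)).card ≤ 16 := by
  by_cases hP : Matrix.det (∑ l, ((X : ℝ[X]) ^ d l) • (S l).map C) = 0
  · rw [hP, Polynomial.roots_zero, Multiset.toFinset_zero, Finset.filter_empty, Finset.card_empty]; omega
  have hlt := Literature.Computability.AlgebraicComplexity.card_roots_toFinset_filter_pos_lt_card_support hP
  have h17 := card_support_le_17_of_nullNull_of_trace_adjugate_eq_zero d S h30 hlow htop h0 h3 htr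
  omega

/-- **`stub_nullNullCeiling` on the sub-stratum `tr(adj S₃ · S₂) = 0`, in the stub's own hypotheses** (`StrictMono d`):
`det S₀ = 0 → det S₃ = 0 → tr(adj S₃ · S₂) = 0 → ≤ 16` distinct positive roots. [folklore] -/
theorem posRoots_le_16_of_nullNull_of_trace_adjugate_eq_zero' (d : Fin 4 → ℕ) (S : Fin 4 → Matrix (Fin 3) (Fin 3) ℝ)
    (hd : StrictMono d) (h0 : (S 0).det = 0) (h3 : (S 3).det = 0) (htr : ((S 3).adjugate * S 2).trace = 0) :
    ((Matrix.det (∑ l, ((X : ℝ[X]) ^ d l) • (S l).map C)).roots.toFinset.filter (fun t => 0 < t)).card ≤ 16 := by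
  have h01 : d 0 < d 1 := hd (by decide)
  have h12 : d 1 < d 2 := hd (by decide)
  have h23 : d 2 < d 3 := hd (by decide)
  have hmin : ∀ l : Fin 3, d 0 ≤ d (Fin.castSucc l) := by
    intro l; fin_cases l
    · exact le_rfl
    · exact h01.le
    · exact (h01.trans h12).le
  refine posRoots_le_16_of_nullNull_of_trace_adjugate_eq_zero d S ?_ ?_ ?_ h0 h3 htr
  · intro f hf k
    -- all three summands are ≥ d 0 and sum to 3 d 0, so each equals d 0, hence f k = 0 by injectivity
    have hge : ∀ i, d 0 ≤ d (Fin.castSucc (f i)) := fun i => hmin (f i)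
    have heq : d (Fin.castSucc (f k)) = d 0 := by
      have hsum : (∑ i, d (Fin.castSucc (f i))) = d (Fin.castSucc (f 0)) + d (Fin.castSucc (f 1)) + d (Fin.castSucc (f 2)) := by
        simp [Fin.sum_univ_three]
      have := hge 0; have := hge 1; have := hge 2
      fin_cases k <;> simp <;> omega
    have hinj := hd.injective heq
    -- `Fin.castSucc (f k) = 0` means `f k = 0`
    have : (Fin.castSucc (f k) : Fin 4) = Fin.castSucc (0 : Fin 3) := by rw [hinj]; rfl
    exact Fin.castSucc_injective _ this
  · intro f h
    have := hmin (f 0); have := hmin (f 1)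
    have hsum : (∑ i, d (Fin.castSucc (f i))) = d (Fin.castSucc (f 0)) + d (Fin.castSucc (f 1)) := by
      simp [Fin.sum_univ_two]
    have : d 0 < d 3 := h01.trans (h12.trans h23)
    omega
  · intro l h
    have := hmin l
    have : d 0 < d 3 := h01.trans (h12.trans h23)
    omega

end Summit.ValiantsHypothesis.ValiantsHypothesis.Theorems.LacunarySymmetroidMatrixDescartes.Census
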